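import Literature.AnabelianGeometry.EtaleTheta.SettingModelChiTwist
import HarnessLib

/-!
# A model of the [EtTh] §1 root, χ-twisted reshape (R78 (B)), part F2c: `Ẑ`-powers `x^Ẑ ⊆ F̂₂` of an arbitrary
# element (`powHat`), the commutator powers `[a,b]^Ẑ`, and their levels

Mochizuki, *The étale theta function …*, Publ. RIMS **45** (2009) [EtTh], §1, PRIMS PDF p. 12
[cite: MochizukiEtTh2009, §1 p.12] ("`Δ_X` … a profinite free group on 2 generators", "`Δ^Θ_X := Δ_X/[Δ_X,[Δ_X,Δ_X]]`",
"`(Ẑ(1) ≅) Δ_Θ`"). Layer L2 of the abc-iut cell, seat abc-iut-w5-d024 (gen 3), R78 cluster (abc-iut-L2-lead RULINGS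
#13 R100; integration owner abc-iut-L6-d6, R78-MAP #2 (3) ask «powHat»): sequel of `SettingModelChiTwist.lean`
(F2) over abc-iut-L2-t1's root model; nothing of another seat edited or restated.

CONTENTS. Since `Ẑ` is free procyclic, every `x ∈ F̂₂` has a unique continuous one-parameter group
`powHat x : Ẑ → F̂₂`, `ι k ↦ x^k` (`ProfiniteCompletion.lift`; `powHat_iotaZ`, `powHat_unique`); F2's `bPow` is
`powHat (η b)` (`bPow_eq_powHat`). Laws: `map_powHat` (continuous endomorphisms commute with `Ẑ`-powers), hence
`twist_powHat`; `apply_powHat_eq_pow` (a continuous `π : F̂₂ → Q` into a group killed by `e`-th powers sees only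
`t mod e`); `toAdd_level_eHat_powHat` (the completed `a`-exponent of `x^t` is `ê(x)·t` level-wise). For the
COMMUTATOR `c = [a,b]` — the topological generator of "`Δ_Θ ≅ Ẑ`" in the model — `cPow := powHat (η c)` has
`eHat_powHat_commutator = 1` and **`hHat_powHat_commutator : ĥ_N (c^t) = (0, 0, t mod N)`**, the `z`-COORDINATISATION
of `Δ_Θ` (input of F1c/F6: χ-isotypy of `Δ_Θ`, «`Δ_Θ(modelχ) ≅ Ẑ(χ)`»), and `twist_powHat_commutator`-type
consequences follow from `twist_powHat`. SEMI-SYNTHETIC MODEL, CONSISTENCY EVIDENCE ONLY; nothing of [EtTh] is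
asserted; no side is taken on [IUTchIII] Cor. 3.12.
-/

noncomputable section

namespace Literature.AnabelianGeometry.EtaleTheta.SettingModel

open Literature.AnabelianGeometry.SemiGraphs
open Literature.AnabelianGeometry.AbsoluteAnabelian
open CategoryTheory Function ProfiniteGrp ProfiniteGrp.ProfiniteCompletion
open scoped commutatorElement

/-! ### `x^Ẑ` -/

/-- **`x^· : Ẑ → F̂₂`**, the continuous one-parameter group through `x ∈ F̂₂` (`ι k ↦ x^k`).
[cite: MochizukiEtTh2009, §1 p.12] -/
def powHat (x : F₂hatT) : ZH →ₜ* F₂hatT :=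
  (ProfiniteGrp.ProfiniteCompletion.lift (P := F₂hat) (GrpCat.ofHom (zpowersHom F₂hatT x))).hom

/-- `x^{ι k} = x^k`. [cite: MochizukiEtTh2009, §1 p.12] -/
theorem powHat_iotaZ (x : F₂hatT) (k : Multiplicative ℤ) : powHat x (iotaZ k) = x ^ (Multiplicative.toAdd k) :=
  lift_hom_toCompletion F₂hat (zpowersHom F₂hatT x) k

/-- `x^{ι 1} = x`. [cite: MochizukiEtTh2009, §1 p.12] -/
theorem powHat_iotaZ_one (x : F₂hatT) : powHat x (iotaZ (Multiplicative.ofAdd 1)) = x := by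
  rw [powHat_iotaZ, toAdd_ofAdd, zpow_one]

/-- **Uniqueness**: a continuous homomorphism `Ẑ → F̂₂` is determined by its value at `ι 1`
(`η(ℤ)` is dense). [cite: MochizukiEtTh2009, §1 p.12] -/
theorem powHat_unique (x : F₂hatT) (f : ZH →ₜ* F₂hatT) (hf : f (iotaZ (Multiplicative.ofAdd 1)) = x) :
    f = powHat x := by
  have h := ZHatCompletion.monoidHom_ext_of_continuous (f₁ := f.toMonoidHom) (f₂ := (powHat x).toMonoidHom)
    f.continuous (powHat x).continuous (by
      change f (iotaZ (Multiplicative.ofAdd 1)) = powHat x (iotaZ (Multiplicative.ofAdd 1))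
      rw [hf, powHat_iotaZ_one])
  exact ContinuousMonoidHom.ext fun t => DFunLike.congr_fun h t

/-- F2's `b^·` is `powHat (η b)`. [cite: MochizukiEtTh2009, §1 p.12] -/
theorem bPow_eq_powHat : bPow = powHat (eta (FreeGroup.of 1)) :=
  powHat_unique _ _ bPow_iotaZ_one

/-- **Continuous endomorphisms commute with `Ẑ`-powers**: `F (x^t) = (F x)^t`. [cite: MochizukiEtTh2009, §1 p.12] -/
theorem map_powHat (F : F₂hatT →ₜ* F₂hatT) (x : F₂hatT) (t : ZH) : F (powHat x t) = powHat (F x) t := by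
  have h := powHat_unique (F x) (F.comp (powHat x)) (by
    change F (powHat x (iotaZ (Multiplicative.ofAdd 1))) = F x
    rw [powHat_iotaZ_one])
  exact DFunLike.congr_fun h t

/-- `θ_φ (x^t) = (θ_φ x)^t`. [cite: MochizukiEtTh2009, §1 p.12] -/
theorem twist_powHat (φ : MulAut ZH) (x : F₂hatT) (t : ZH) : twist φ (powHat x t) = powHat (twist φ x) t :=
  map_powHat ((twist φ : F₂hatT ≃ₜ* F₂hatT) : F₂hatT →ₜ* F₂hatT) x t

/-- **`π (x^t) = π(x)^{t mod e}`** for a continuous homomorphism `π : F̂₂ → Q` into a group killed by `e`-th powers.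
[cite: MochizukiEtTh2009, §1 p.12] -/
theorem apply_powHat_eq_pow {Q : Type*} [Group Q] [TopologicalSpace Q] (π : F₂hatT →ₜ* Q) (e : ℕ+)
    (he : ∀ q : Q, q ^ (e : ℕ) = 1) (x : F₂hatT) (t : ZH) :
    π (powHat x t) = π x ^ (Multiplicative.toAdd (ZHatLevel.level e t)).val := by
  haveI : NeZero (e : ℕ) := ⟨e.ne_zero⟩
  set k : ℕ := (Multiplicative.toAdd (ZHatLevel.level e t)).val with hkdef
  have hk : ZHatLevel.level e t = ZHatLevel.level e (ZHatLevel.eta (k : ℤ)) := by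
    rw [ZHatLevel.level_eta, Int.cast_natCast, hkdef, ZMod.natCast_zmod_val, ofAdd_toAdd]
  have h1 : ZHatLevel.level e (t * (ZHatLevel.eta (k : ℤ))⁻¹) = 1 := by
    rw [map_mul, map_inv, hk, mul_inv_cancel]
  obtain ⟨z, hz⟩ := (ZHatLevel.level_eq_one_iff_exists_pow e _).mp h1
  have ht : t = z ^ (e : ℕ) * ZHatLevel.eta (k : ℤ) := by rw [hz, inv_mul_cancel_right]
  have hb : powHat x (ZHatLevel.eta (k : ℤ)) = x ^ k := by
    change powHat x (iotaZ (Multiplicative.ofAdd (k : ℤ))) = _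
    rw [powHat_iotaZ, toAdd_ofAdd, zpow_natCast]
  rw [ht, map_mul, map_mul, map_pow, map_pow, he, one_mul, hb, map_pow]

/-- **The completed `a`-exponent of `x^t` is `ê(x)·t`**, read at every level: `ê(x^t) ≡ ê(x)·t (mod N)`
(`ZHatLevel.level_map` for the endomorphism `ê ∘ x^·` of `Ẑ`). [cite: MochizukiEtTh2009, §1 p.12] -/
theorem toAdd_level_eHat_powHat (N : ℕ+) (x : F₂hatT) (t : ZH) :
    Multiplicative.toAdd (ZHatLevel.level N (eHat (powHat x t))) =
      Multiplicative.toAdd (ZHatLevel.level N (eHat x)) * Multiplicative.toAdd (ZHatLevel.level N t) := by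
  have h := ZHatLevel.level_map N (eHat.toMonoidHom.comp (powHat x).toMonoidHom) t
  have h1 : (eHat.toMonoidHom.comp (powHat x).toMonoidHom) (ZHatLevel.eta 1) = eHat x := by
    change eHat (powHat x (iotaZ (Multiplicative.ofAdd 1))) = eHat x
    rw [powHat_iotaZ_one]
  rw [h1] at h
  exact h

/-! ### The commutator powers `[a,b]^Ẑ` — the `z`-axis of the theta quotient -/

/-- `ê([a,b]^t) = 1`: commutator powers have trivial `a`-exponent. [cite: MochizukiEtTh2009, §1 p.12] -/
theorem eHat_powHat_commutator (t : ZH) :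
    eHat (powHat (eta ⁅FreeGroup.of (0 : Fin 2), FreeGroup.of 1⁆) t) = 1 := by
  have h := ZHatCompletion.monoidHom_ext_of_continuous
    (f₁ := eHat.toMonoidHom.comp (powHat (eta ⁅FreeGroup.of (0 : Fin 2), FreeGroup.of 1⁆)).toMonoidHom)
    (f₂ := (1 : ZH →* ZH))
    (eHat.continuous.comp (powHat _).continuous) continuous_const (by
      change eHat (powHat _ (iotaZ (Multiplicative.ofAdd 1))) = 1
      rw [powHat_iotaZ_one, eHat_eta, expA_apply, map_commutatorElement, Heis.commutatorElement_eq]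
      simp)
  exact DFunLike.congr_fun h t

/-- **`ĥ_N ([a,b]^t) = (0, 0, t mod N)`**: on the commutator powers the Heisenberg level map is the level-`N`
character on the `z`-axis — the `z`-coordinatisation of "`Δ_Θ ≅ Ẑ`" in the model. [cite: MochizukiEtTh2009, §1 p.12] -/
theorem hHat_powHat_commutator (N : ℕ+) (t : ZH) :
    hHat N (powHat (eta ⁅FreeGroup.of (0 : Fin 2), FreeGroup.of 1⁆) t) =
      ⟨0, 0, Multiplicative.toAdd (ZHatLevel.level N t)⟩ := by
  haveI : NeZero (N : ℕ) := ⟨N.ne_zero⟩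
  have hc : hHat N (eta ⁅FreeGroup.of (0 : Fin 2), FreeGroup.of 1⁆) = ⟨0, 0, 1⟩ := by
    rw [hHat_eta, heisHom_commutator, Heis.map_apply]
    ext <;> simp
  have he : ∀ q : Heis (ZMod N), q ∈ Set.range (fun s : ZH => hHat N (powHat (eta ⁅FreeGroup.of (0 : Fin 2),
      FreeGroup.of 1⁆) s)) → q ^ (N : ℕ) = 1 := by
    rintro _ ⟨s, rfl⟩
    have hx : (hHat N (powHat (eta ⁅FreeGroup.of (0 : Fin 2), FreeGroup.of 1⁆) s)).x = 0 :=
      hHat_x_eq_zero_of_eHat_eq_one N (eHat_powHat_commutator s)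
    rw [Heis.pow_eq_of_x_eq_zero _ hx, ZMod.natCast_self, zero_mul, zero_mul]; rfl
  -- decompose `t = z^N · η k` as in `apply_powHat_eq_pow`, inside the image subgroup
  set k : ℕ := (Multiplicative.toAdd (ZHatLevel.level N t)).val with hkdef
  have hk : ZHatLevel.level N t = ZHatLevel.level N (ZHatLevel.eta (k : ℤ)) := by
    rw [ZHatLevel.level_eta, Int.cast_natCast, hkdef, ZMod.natCast_zmod_val, ofAdd_toAdd]
  have h1 : ZHatLevel.level N (t * (ZHatLevel.eta (k : ℤ))⁻¹) = 1 := by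
    rw [map_mul, map_inv, hk, mul_inv_cancel]
  obtain ⟨z, hz⟩ := (ZHatLevel.level_eq_one_iff_exists_pow N _).mp h1
  have ht : t = z ^ (N : ℕ) * ZHatLevel.eta (k : ℤ) := by rw [hz, inv_mul_cancel_right]
  have hb : powHat (eta ⁅FreeGroup.of (0 : Fin 2), FreeGroup.of 1⁆) (ZHatLevel.eta (k : ℤ)) =
      eta ⁅FreeGroup.of (0 : Fin 2), FreeGroup.of 1⁆ ^ k := by
    change powHat _ (iotaZ (Multiplicative.ofAdd (k : ℤ))) = _
    rw [powHat_iotaZ, toAdd_ofAdd, zpow_natCast]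
  rw [ht, map_mul, map_mul, map_pow, map_pow, he _ ⟨z, rfl⟩, one_mul, hb, map_pow, hc,
    Heis.pow_eq_of_x_eq_zero _ rfl, map_mul, ZHatLevel.level_pow_self, one_mul, ZHatLevel.level_eta,
    toAdd_ofAdd, Int.cast_natCast]
  ext <;> simp

/-- `θ_φ ([a,b]^t) = (θ_φ [a,b])^t` and `θ_φ [a,b] = [η a, b^{φ(1)}]`: the twist acts on the commutator powers
through its action on `[a,b]`. [cite: MochizukiEtTh2009, §1 p.12] -/
theorem twist_eta_commutator (φ : MulAut ZH) :
    twist φ (eta ⁅FreeGroup.of (0 : Fin 2), FreeGroup.of 1⁆) =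
      ⁅eta (FreeGroup.of 0), bPow (φ (iotaZ (Multiplicative.ofAdd 1)))⁆ := by
  rw [map_commutatorElement, map_commutatorElement, twist_eta_of_zero, twist_eta_of_one]

/-- **Levels of the twisted commutator powers**: `ĥ_N (θ_φ ([a,b]^t)) = (0, 0, χ_N(φ)·(t mod N))` — the twist acts
on the `z`-axis `Δ_Θ` by the level-`N` cyclotomic character (χ-isotypy of `Δ_Θ` in the model).
[cite: MochizukiEtTh2009, §1 p.12] -/
theorem hHat_twist_powHat_commutator (N : ℕ+) (φ : MulAut ZH) (t : ZH) :
    hHat N (twist φ (powHat (eta ⁅FreeGroup.of (0 : Fin 2), FreeGroup.of 1⁆) t)) =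
      ⟨0, 0, ZHatLevel.levelChar N φ * Multiplicative.toAdd (ZHatLevel.level N t)⟩ := by
  rw [hHat_twist, hHat_powHat_commutator, Heis.diagTwist_apply]
  ext <;> simp

end Literature.AnabelianGeometry.EtaleTheta.SettingModel

end
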